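import Summits.Ventures.HSemireg.WedgeHankelSecantKernel

/-!
# Venture HSemireg — THE SECANT IMAGE LAW: `V(univ, w_m(Σ_{i<r} A_i λ_i^•), k) = ⊕_{i<r} V(univ, w_m(λ_i^•), k)` for `r ≤ min(k+1, m+1−k)`
# (the image of a secant class is the DIRECT sum of the images of its exponentials)

HONEST FRAMING. Part of the Lean index of the computation cell `pub-hsemireg` (seat p10 gen 14, Sunday typer «UNIFORM-IN-n»).
Finite-dimensional EXTERIOR ALGEBRA over a field and ranks of HANKEL MATRICES ONLY: no variety, no cohomology theory, no sheaf, no Ext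
group and no semiregularity map is constructed here; nothing here says that HC / HC_CM / HC_AV holds; no Literature fact is declared or
used.  Custodian versions cited: theory/FORMULA-N.md PART A §2.2 THEOREM T / §2.6 THEOREM H and the KRONECKER DICTIONARY; STRUCTURE.md
v1.0-SIGNED 9b196a05977dd067 §1.1 C15.  The dictionary (`Σ_i A_i exp(λ_i Θ)` ↦ `q_j = Σ_i A_i λ_i^j` ↦ `w_m(q)`; the IMAGE `V(univ, w_m(q), k)` of
`θ ↦ θ ∧ w_m(q)` on `⋀^k` ↔ the Ext side BY VALUE) is QUOTED, never asserted.

WHAT IS KEYED.  D1/D2: the secant rank law `rank H_k = min(r, k+1)` and THE SECANT KERNEL LAW `Kr = ⋂_{i<r} F_{λ_i}(k)`; 591: a pure class has rank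
`C(m,k)` on `⋀^k`; C9 (tree): the Künneth IMAGE law for boxes.  THIS FILE is the image-side companion of D2 on ONE factor:
* §1 `dim V(univ, w_m(Aλ^•), k) = C(m,k)` (591 in th-7's `V` language); **`V_w_secSeq_le_iSup`: `V(univ, w_m(Σ_i A_i λ_i^•), k) ≤ Σ_i V(univ, w_m(λ_i^•), k)`**
  (θ ∧ Σ_i A_i u_i = Σ_i A_i (θ ∧ u_i)); `dim Σ_i V_i ≤ Σ_i dim V_i = r·C(m,k)` (`finrank_sup_le_sum`, generic).
* §2 **THE SECANT IMAGE LAW `V_w_secSeq_eq_iSup`: for distinct slopes, non-zero weights, `r ≤ k + 1`, `r ≤ m + 1 − k`: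
  `V(univ, w_m(Σ_{i<r} A_i λ_i^•), k) = Σ_{i<r} V(univ, w_m(λ_i^•), k)` and the sum is DIRECT — `dim Σ_i V_i = Σ_i dim V_i = r·C(m,k)`
  (`finrank_iSup_V_expSeq`)** — D1's count `r·C(m,k)` from below meets the sum bound from above.  `r = 2` is th-7's THEOREM T shape
  («rank of the transverse pair = 2·C(m,k)», `0 < k < m`), now for every `r` in range; wedge-range form `range_wedge_w_secSeq`; the `r` images are
  INDEPENDENT (`iSupIndep_V_expSeq`: an internal direct sum).
Namespace `Summit.Ventures.HSemireg.Wedge.HankelSecant` (continued); new names only.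
-/

open Module

namespace Summit.Ventures.HSemireg.Wedge.HankelSecant

open Summit.Ventures.HSemireg.Wedge Summit.Ventures.HSemireg.Wedge.Kunneth Summit.Ventures.HSemireg.Wedge.KunnethKernel
  Summit.Ventures.HSemireg.Wedge.HankelFaces Summit.Ventures.HSemireg.Wedge.HankelPureKernel

variable (K : Type*) [Field K] (m : ℕ)

/-! ## §1. Images of pure classes; the sum bound -/

/-- `V(univ, f, a)` is the range of th-7's `θ ↦ θ ∧ f ∣ ⋀^a` (private copy; cf. C3's `V_univ_w`). -/
private lemma V_univ_eq_range₅ (a : ℕ) (f : HT K (Hankel.In m)) :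
    V K (Hankel.In m) Finset.univ f a = LinearMap.range (Hankel.wedge K m a f) := by
  rw [V_eq_map, Hom_univ_eq_exteriorPower, Hankel.wedge, LinearMap.range_comp, Submodule.range_subtype]

/-- **`dim V(univ, w_m(Aλ^•), k) = C(m,k)`** for `A ≠ 0` (591's pure rank, in th-7's `V` language). -/
theorem finrank_V_w_expSeq {A : K} (hA : A ≠ 0) (lam : K) (k : ℕ) :
    finrank K (V K (Hankel.In m) Finset.univ (Hankel.w K m m (expSeq K A lam)) k) = m.choose k := by
  rw [V_univ_eq_range₅, finrank_range_wedge_w_expSeq K m hA lam k]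

/-- **`V(univ, w_m(Σ_i A_i λ_i^•), k) ≤ Σ_i V(univ, w_m(λ_i^•), k)`**: `θ ∧ Σ_i A_i u_i = Σ_i A_i (θ ∧ u_i)` (any slopes and weights). -/
theorem V_w_secSeq_le_iSup {r : ℕ} (A lam : Fin r → K) (k : ℕ) :
    V K (Hankel.In m) Finset.univ (Hankel.w K m m (secSeq K A lam)) k ≤
      ⨆ i, V K (Hankel.In m) Finset.univ (Hankel.w K m m (expSeq K 1 (lam i))) k := by
  rw [V_eq_map]
  rintro _ ⟨θ, hθ, rfl⟩
  rw [LinearMap.mulRight_apply, w_secSeq, Finset.mul_sum]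
  refine Submodule.sum_mem _ fun i _ => ?_
  rw [mul_smul_comm]
  refine Submodule.smul_mem _ _ (Submodule.mem_iSup_of_mem i ?_)
  rw [V_eq_map]
  exact ⟨θ, hθ, by rw [LinearMap.mulRight_apply, w_expSeq, one_smul]⟩

/-- dimension is subadditive over finite sups: `dim (sup_{i∈s} F_i) ≤ Σ_{i∈s} dim F_i` (generic, finite-dimensional ambient space). -/
theorem finrank_sup_le_sum {M : Type*} [AddCommGroup M] [Module K M] [FiniteDimensional K M] {ι : Type*} (s : Finset ι)
    (F : ι → Submodule K M) : finrank K ↥(s.sup F) ≤ ∑ i ∈ s, finrank K (F i) := by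
  classical
  induction s using Finset.induction_on with
  | empty => rw [Finset.sup_empty, finrank_bot, Finset.sum_empty]
  | insert a s ha ih =>
    rw [Finset.sup_insert, Finset.sum_insert ha]
    exact (Submodule.finrank_add_le_finrank_add_finrank _ _).trans (by omega)

/-- hence **`dim Σ_{i<r} V(univ, w_m(λ_i^•), k) ≤ r·C(m,k)`** (any slopes). -/
theorem finrank_iSup_V_expSeq_le {r : ℕ} (lam : Fin r → K) (k : ℕ) :
    finrank K ↥(⨆ i, V K (Hankel.In m) Finset.univ (Hankel.w K m m (expSeq K 1 (lam i))) k) ≤ r * m.choose k := by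
  have h := finrank_sup_le_sum K Finset.univ fun i : Fin r => V K (Hankel.In m) Finset.univ (Hankel.w K m m (expSeq K 1 (lam i))) k
  rw [Finset.sup_univ_eq_iSup] at h
  simp only [finrank_V_w_expSeq K m one_ne_zero, Finset.sum_const, Finset.card_univ, Fintype.card_fin, smul_eq_mul] at h
  exact h

/-! ## §2. The secant image law -/

/-- the image NUMBER of an `r`-secant class (`r ≤ k+1`, `r ≤ m+1−k`, distinct slopes, non-zero weights): **`dim V = r·C(m,k)`** (D1 + THEOREM H). -/
theorem finrank_V_w_secSeq {r k : ℕ} (hrk : r ≤ k + 1) (hrm : r ≤ m + 1 - k) {A lam : Fin r → K} (hA : ∀ i, A i ≠ 0)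
    (hlam : Function.Injective lam) :
    finrank K (V K (Hankel.In m) Finset.univ (Hankel.w K m m (secSeq K A lam)) k) = r * m.choose k := by
  rw [V_univ_eq_range₅, finrank_range_wedge_w_secSeq hrk hrm hA hlam, Nat.mul_comm]

/-- **THE SECANT IMAGE LAW.**  For distinct slopes `λ_0, …, λ_{r−1}`, non-zero weights, `r ≤ k + 1` and `r ≤ m + 1 − k`:
**`V(univ, w_m(Σ_{i<r} A_i λ_i^•), k) = Σ_{i<r} V(univ, w_m(λ_i^•), k)`** — the image of `θ ↦ θ ∧ w_m(q)` on `⋀^k` is the sum of the images of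
the `r` exponentials (every field, `m`); `r = 2` is th-7's THEOREM T in submodule form. -/
theorem V_w_secSeq_eq_iSup {r k : ℕ} (hrk : r ≤ k + 1) (hrm : r ≤ m + 1 - k) {A lam : Fin r → K} (hA : ∀ i, A i ≠ 0)
    (hlam : Function.Injective lam) :
    V K (Hankel.In m) Finset.univ (Hankel.w K m m (secSeq K A lam)) k =
      ⨆ i, V K (Hankel.In m) Finset.univ (Hankel.w K m m (expSeq K 1 (lam i))) k := by
  refine Submodule.eq_of_le_of_finrank_le (V_w_secSeq_le_iSup K m A lam k) ?_
  rw [finrank_V_w_secSeq K m hrk hrm hA hlam]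
  exact finrank_iSup_V_expSeq_le K m lam k

/-- … and **the sum is DIRECT: `dim Σ_{i<r} V(univ, w_m(λ_i^•), k) = r·C(m,k) = Σ_i dim V(univ, w_m(λ_i^•), k)`** (distinct slopes,
`r ≤ min(k+1, m+1−k)`) — the images of `r` exponentials in general position are independent. -/
theorem finrank_iSup_V_expSeq {r k : ℕ} (hrk : r ≤ k + 1) (hrm : r ≤ m + 1 - k) {lam : Fin r → K} (hlam : Function.Injective lam) :
    finrank K ↥(⨆ i, V K (Hankel.In m) Finset.univ (Hankel.w K m m (expSeq K 1 (lam i))) k) = r * m.choose k := by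
  rw [← V_w_secSeq_eq_iSup K m hrk hrm (A := fun _ => (1 : K)) (fun _ => one_ne_zero) hlam]
  exact finrank_V_w_secSeq K m hrk hrm (fun _ => one_ne_zero) hlam

/-- in particular the image of a secant class does not depend on its (non-zero) weights. -/
theorem V_w_secSeq_indep {r k : ℕ} (hrk : r ≤ k + 1) (hrm : r ≤ m + 1 - k) {A A' lam : Fin r → K} (hA : ∀ i, A i ≠ 0)
    (hA' : ∀ i, A' i ≠ 0) (hlam : Function.Injective lam) :
    V K (Hankel.In m) Finset.univ (Hankel.w K m m (secSeq K A lam)) k = V K (Hankel.In m) Finset.univ (Hankel.w K m m (secSeq K A' lam)) k := by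
  rw [V_w_secSeq_eq_iSup K m hrk hrm hA hlam, V_w_secSeq_eq_iSup K m hrk hrm hA' hlam]

/-- wedge-range form: **`range(θ ↦ θ ∧ w_m(Σ_i A_i λ_i^•) ∣ ⋀^k) = Σ_i range(θ ↦ θ ∧ w_m(λ_i^•) ∣ ⋀^k)`**, same hypotheses. -/
theorem range_wedge_w_secSeq {r k : ℕ} (hrk : r ≤ k + 1) (hrm : r ≤ m + 1 - k) {A lam : Fin r → K} (hA : ∀ i, A i ≠ 0)
    (hlam : Function.Injective lam) :
    LinearMap.range (Hankel.wedge K m k (Hankel.w K m m (secSeq K A lam))) =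
      ⨆ i, LinearMap.range (Hankel.wedge K m k (Hankel.w K m m (expSeq K 1 (lam i)))) := by
  rw [← V_univ_eq_range₅, V_w_secSeq_eq_iSup K m hrk hrm hA hlam]
  exact iSup_congr fun i => V_univ_eq_range₅ K m k _

/-- beyond the range — MORE NODES THAN ROWS (`k + 1 ≤ r ≤ m + 1 − k`): the image is still the sum of the exponentials' images, now of the
generic dimension `(k+1)·C(m,k)` (D1's full rank), so the `r` images are NO LONGER independent. -/
theorem finrank_V_w_secSeq_of_le {r k : ℕ} (hkr : k + 1 ≤ r) (hrm : r ≤ m + 1 - k) {A lam : Fin r → K} (hA : ∀ i, A i ≠ 0)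
    (hlam : Function.Injective lam) :
    finrank K (V K (Hankel.In m) Finset.univ (Hankel.w K m m (secSeq K A lam)) k) = (k + 1) * m.choose k := by
  rw [V_univ_eq_range₅, Hankel.hankelLaw_model, rank_hankel1_secSeq_of_le hkr hrm hA hlam, Nat.mul_comm]

/-- **THE IMAGES OF EXPONENTIALS IN GENERAL POSITION ARE INDEPENDENT** (`iSupIndep`, i.e. an internal direct sum): for distinct slopes and
`r ≤ min(k+1, m+1−k)`, each `V(univ, w_m(λ_i^•), k)` meets the sum of the others trivially — the dimension count `r·C(m,k)` leaves no room. -/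
theorem iSupIndep_V_expSeq {r k : ℕ} (hrk : r ≤ k + 1) (hrm : r ≤ m + 1 - k) {lam : Fin r → K} (hlam : Function.Injective lam) :
    iSupIndep fun i => V K (Hankel.In m) Finset.univ (Hankel.w K m m (expSeq K 1 (lam i))) k := by
  classical
  rw [iSupIndep_def]
  intro i
  rw [disjoint_iff, ← Submodule.finrank_eq_zero]
  have hr : 1 ≤ r := Nat.succ_le_of_lt (Fin.pos i)
  have hall := finrank_iSup_V_expSeq K m hrk hrm hlam
  have hi : finrank K (V K (Hankel.In m) Finset.univ (Hankel.w K m m (expSeq K 1 (lam i))) k) = m.choose k :=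
    finrank_V_w_expSeq K m one_ne_zero (lam i) k
  have e1 : ((Finset.univ.erase i).sup fun j => V K (Hankel.In m) Finset.univ (Hankel.w K m m (expSeq K 1 (lam j))) k) =
      ⨆ (j) (_ : j ≠ i), V K (Hankel.In m) Finset.univ (Hankel.w K m m (expSeq K 1 (lam j))) k := by
    rw [Finset.sup_eq_iSup]
    simp only [Finset.mem_erase, Finset.mem_univ, and_true]
  have hrest : finrank K ↥(⨆ (j) (_ : j ≠ i), V K (Hankel.In m) Finset.univ (Hankel.w K m m (expSeq K 1 (lam j))) k) ≤ (r - 1) * m.choose k := by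
    rw [← e1]
    refine (finrank_sup_le_sum K _ _).trans (le_of_eq ?_)
    simp only [finrank_V_w_expSeq K m one_ne_zero, Finset.sum_const, Finset.card_erase_of_mem (Finset.mem_univ i), Finset.card_univ,
      Fintype.card_fin, smul_eq_mul]
  have hsplit := iSup_split_single (fun j => V K (Hankel.In m) Finset.univ (Hankel.w K m m (expSeq K 1 (lam j))) k) i
  have key := Submodule.finrank_sup_add_finrank_inf_eq (V K (Hankel.In m) Finset.univ (Hankel.w K m m (expSeq K 1 (lam i))) k)
    (⨆ (j) (_ : j ≠ i), V K (Hankel.In m) Finset.univ (Hankel.w K m m (expSeq K 1 (lam j))) k)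
  rw [← hsplit, hall, hi] at key
  have e : r * m.choose k = (r - 1) * m.choose k + m.choose k := by
    rw [Nat.sub_one_mul]; exact (Nat.sub_add_cancel (Nat.le_mul_of_pos_left _ hr)).symm
  omega

end Summit.Ventures.HSemireg.Wedge.HankelSecant
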